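import Summits.Ventures.CertifiedManyBodySolver.Certificates.HubbardTTPrime_polarizedBandCaps_kernelA
import Summits.Ventures.CertifiedManyBodySolver.Observables.PhaseSeparationExclusionSevenEighthsAnchors
import Summits.Ventures.CertifiedManyBodySolver.Observables.PhaseSeparationExclusionSevenEighthsAnchorsThreeTenths
import Summits.Ventures.CertifiedManyBodySolver.Observables.PhaseSeparationExclusionTPrimeStripTwoFifths
import HarnessLib
import HarnessLib.Audit

/-!
# Ventures/CertifiedManyBodySolver — Observables/PhaseSeparationExclusionSevenEighthsAnchorsPol.lean (the cuprate-strip `(≤ n₁ | ≥ 7/8)` words ABOVE the `U = 12` column, POLARISED-CAP edition: every `U ≥ 12`)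

HONEST FRAMING: first certified bounds; not a superconductivity verdict. CLASS = DERIVED / CONTEXT: instantiation of the PROVED law
`ps_not_groundState_mix_above_column_tcap` (`Observables/PhaseSeparationExclusionTPrimeStripTwoFifths`) on (i) the LANDED `n = 7/8` column law at `U = 12` on
`t′ ∈ [-3/10, -1/5]` — `se78_col12_m30m20` of `…SevenEighthsAnchors` (hubbard-box-p3 g30), the `t′`-chord of the registry corner floors #595 `(12, 7/8, −3/10)` and
#592 `(12, 7/8, −1/5)`, claim nodes BY NAME — which floors every `U ≥ 12` (Griffiths), (ii) the landed dilute chords `se78_dilute{1o5,1o4,3o10}_m30m20`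
(PREMISE-FREE kernel Fermi-sea tangent rows), and (iii) the PROVED kernel FULLY-POLARISED band cap `polHalf_m30m20` (`Certificates/HubbardTTPrime_polarizedBandCaps_kernelA`,
hubbard-box-p3 g33: one spin species filling half of its band, no double occupancy, `e(1, s, U, 1/2) ≤ -0.8009104 + 0.0939350·s` for EVERY `U ≥ 0`). No new
certificate, no CERTIFIED row, no cell word of the meter's kind, no MOVE. Seat hubbard-box-p3 g33 (`prover-hubbard-box-p3-g33-0`); generator
`pub/hubbard-fast/hubbard-box-p3/work-g33/far78/emit_far78.py` (`FAR78_ROUND=3`; exact `fractions`; decimals = 10-place DOWNWARD roundings).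

THE POINT. g30's `(≤ n₁ | ≥ 7/8)` words on the La-214 segment `t′ ∈ [−3/10, −1/5]` (`sevenEighths_not_groundState_mix_le_{1o5,1o4,3o10}_ge_7o8_B`) stop at
`U = 479/20 ∣ 19 ∣ 281/20`: their witness cap, the registry filling-`1/2` plane r468, grows by `0.0117·U`, so «above the top column `U = 12`» the margin dies —
for `(≤ 3/10 | ≥ 7/8)` already at `U = 14.05`, INSIDE the routed La₂₋ₓSrₓCuO₄ / LBCO box `[−0.3, −0.2] × [5.9, 14.7]` (psbox v1.5: «(3/10∣7/8) 0.96, holes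
U ∈ [14.05, 14.7]»). The polarised cap does not depend on `U` at all and sits at `−0.829 ∣ −0.820` on this segment (below r468 from `U ≈ 6 ∣ 11.5` on): against the
Griffiths-monotone `U = 12` floor the three sentences hold for EVERY `U ≥ 12` (stated up to `U = 100`), margins `+0.2101 ∣ +0.1756` (1/5), `+0.1555 ∣ +0.1117` (1/4),
`+0.0937 ∣ +0.0422` (3/10) at `s = −3/10 ∣ −1/5`. Consequence (routed boxes, next supplement file): `(≤ 3/10 | ≥ 7/8)` on the WHOLE La-214 family box — rows
M13–M17, M53, M54, M107–M109.

WHAT IT SAYS (`t = 1`, thermodynamic limit; conditional BY NAME on #595, #592 only): for every `(s, U) ∈ [−3/10, −1/5] × [12, 100]` no mixture `λω₁ + (1−λ)ω₂`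
(`0 < λ < 1`) of translation-invariant states with densities `0 < ρ(ω₁) ≤ n₁` and `7/8 ≤ ρ(ω₂) < 2` is a ground state, at ANY filling in between, for
`n₁ ∈ {1/5, 1/4, 3/10}` (`sevenEighthsPol_not_groundState_mix_le_{1o5,1o4,3o10}_ge_7o8_B`). `(≤ 2/5 | ≥ 7/8)` does NOT certify here (best margin negative).
WHAT THIS IS NOT: a certificate; a CERTIFIED row; a statement at `t′ > 0`, `T > 0`, or about stripes / which phase is realised / ferromagnetism / superconductivity.
[cite: Israel1979, Thm. I.2.4] [cite: EmeryKivelsonLin1990, pp. 475–476] [cite: Ruelle1969, §3.3] [cite: Griffiths1966, §II] [cite: BachLiebSolovej1994, eq. (2c.36)]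
-/

noncomputable section

namespace Summit.Ventures.CertifiedManyBodySolver.Observables

open Summit.Ventures.CertifiedManyBodySolver.Certificates Summit.Ventures.CertifiedManyBodySolver.Downfold
open Literature.MathematicalPhysics.QuantumLattice Literature.MathematicalPhysics.QuantumLattice.ThermodynamicLimit
open Literature.MathematicalPhysics.QuantumLattice.InfVolFermionState Set

/-! ## The `(≤ 1/5 | ≥ 7/8)` cells and rectangle words -/

/-- **`(≤ 1/5 | ≥ 7/8)` — segment B above the column `U = 12`: `t′ ∈ [-3 / 10, -1 / 5]`, `U ∈ [12, 100]`** (cap filling `1 / 2`, weights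
`5 / 9, 4 / 9`; cap = the PROVED kernel FULLY-POLARISED band cap `polHalf_m30m20` (one spin species at density `1 / 2`, `U`-independent; no claim node); the `n = 7/8` column law `se78_col12_m30m20` floors every larger `U`
[folklore: `energyDensityTT'_mono_U`]; the cap grows by `c₁ = 0.0000000` per unit `U`; margins at `U = 12`: 0.2101053201 ∣ 0.1756410372,
at the far end `U = 100`: 0.2101053201 ∣ 0.1756410372). [cite: Israel1979, Thm. I.2.4] [cite: EmeryKivelsonLin1990, pp. 475–476] [cite: Ruelle1969, §3.3] -/
theorem se78p_1o5_B_above (h595 : cert_r595_bs_GU12n7o8tpm3o10_w3_b4_R2_ob5p2_kry1_kry2c3rel_hanK7B4D4_KN4_PR20d4_uprime) (h592 : cert_r592_bs_GU12n7o8tpm1o5_w3_b4_R2_ob5p2_kry1_kry2c3rel_hanK7B4D4_KN4_PR20d4_uprime)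
    {s : ℝ} (hs : s ∈ Icc (-3 / 10 : ℝ) (-1 / 5 : ℝ)) {U : ℝ} (hU : U ∈ Icc (12 : ℝ) (100 : ℝ))
    {ω₁ ω₂ : InfVolFermionState 2} (h₁ : ω₁.IsTranslationInvariant) (h₂ : ω₂.IsTranslationInvariant)
    (hρ₁ : 0 < ω₁.density) (hρ₁' : ω₁.density ≤ (1 / 5)) (hρ₂ : 7 / 8 ≤ ω₂.density) (hρ₂' : ω₂.density < 2)
    {lam : ℝ} (hl0 : 0 < lam) (hl1 : lam < 1) :
    energyDensityTT' 1 s U (mix lam hl0.le hl1.le ω₁ ω₂).density <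
      (mix lam hl0.le hl1.le ω₁ ω₂).meanEnergy (hubbardTTPrimeFermionInteraction 1 s U) 1 := by
  refine ps_not_groundState_mix_above_column_tcap 1 (s₁ := -3 / 10) (s₂ := -1 / 5) (U₂ := 12) (U₃ := 100)
    (n₁ := (1 / 5)) (n₂ := 7 / 8) (a := 5 / 9) (b := 4 / 9) (by norm_num) (by norm_num) (by norm_num) (by norm_num)
    (by norm_num) (by norm_num) (by norm_num) (by norm_num)
    (polHalf_m30m20_tcap_on_cell (by norm_num) (by norm_num) (by norm_num) (by norm_num))
    (fun s hs => se78_col12_m30m20 h595 h592 s ⟨hs.1.trans' (by norm_num), hs.2.trans (by norm_num)⟩)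
    (fun s hs U hU => se78_dilute1o5_m30m20 (n₁ := (1 / 5)) (by norm_num) (by norm_num) s ⟨hs.1.trans' (by norm_num), hs.2.trans (by norm_num)⟩ U (by linarith [hU.1]))
    ?_ hs hU h₁ h₂ hρ₁ hρ₁' hρ₂ hρ₂' hl0 hl1
  intro s hs; obtain ⟨h1, h2⟩ := hs; push_cast; norm_num; nlinarith [h1, h2]

/-- **THE `(≤ 1/5 | ≥ 7/8)` SENTENCE ON `t′ ∈ [-3 / 10, -1 / 5] × U ∈ [12, 100]`** (segment B; union of 1 piece(s) in `U`). For every `(s, U)` of the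
rectangle no mixture `λω₁ + (1−λ)ω₂` (`0 < λ < 1`) of translation-invariant states of the 2D `t–t′` Hubbard model at `(1, s, U)` with densities `0 < ρ(ω₁) ≤ 1/5` and
`7/8 ≤ ρ(ω₂) < 2` is a ground state — at ANY filling in between: the hole-poor member may carry ANY hole doping up to `1/8` (or be electron doped). Conditional BY NAME on
the registry claim nodes in the signature (`n = 7/8` corner floors, and the r468 plane where it is the cap); kernel HF caps and dilute floors are premise-free. [cite: Israel1979, Thm. I.2.4] [cite: EmeryKivelsonLin1990, pp. 475–476] [cite: Ruelle1969, §3.3] -/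
theorem sevenEighthsPol_not_groundState_mix_le_1o5_ge_7o8_B (h595 : cert_r595_bs_GU12n7o8tpm3o10_w3_b4_R2_ob5p2_kry1_kry2c3rel_hanK7B4D4_KN4_PR20d4_uprime) (h592 : cert_r592_bs_GU12n7o8tpm1o5_w3_b4_R2_ob5p2_kry1_kry2c3rel_hanK7B4D4_KN4_PR20d4_uprime)
    {s : ℝ} (hs : s ∈ Icc (-3 / 10 : ℝ) (-1 / 5 : ℝ)) {U : ℝ} (hU : U ∈ Icc (12 : ℝ) (100 : ℝ))
    {ω₁ ω₂ : InfVolFermionState 2} (h₁ : ω₁.IsTranslationInvariant) (h₂ : ω₂.IsTranslationInvariant)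
    (hρ₁ : 0 < ω₁.density) (hρ₁' : ω₁.density ≤ (1 / 5)) (hρ₂ : 7 / 8 ≤ ω₂.density) (hρ₂' : ω₂.density < 2)
    {lam : ℝ} (hl0 : 0 < lam) (hl1 : lam < 1) :
    energyDensityTT' 1 s U (mix lam hl0.le hl1.le ω₁ ω₂).density <
      (mix lam hl0.le hl1.le ω₁ ω₂).meanEnergy (hubbardTTPrimeFermionInteraction 1 s U) 1 := by
  exact se78p_1o5_B_above h595 h592 hs hU h₁ h₂ hρ₁ hρ₁' hρ₂ hρ₂' hl0 hl1


/-! ## The `(≤ 1/4 | ≥ 7/8)` cells and rectangle words -/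

/-- **`(≤ 1/4 | ≥ 7/8)` — segment B above the column `U = 12`: `t′ ∈ [-3 / 10, -1 / 5]`, `U ∈ [12, 100]`** (cap filling `1 / 2`, weights
`3 / 5, 2 / 5`; cap = the PROVED kernel FULLY-POLARISED band cap `polHalf_m30m20` (one spin species at density `1 / 2`, `U`-independent; no claim node); the `n = 7/8` column law `se78_col12_m30m20` floors every larger `U`
[folklore: `energyDensityTT'_mono_U`]; the cap grows by `c₁ = 0.0000000` per unit `U`; margins at `U = 12`: 0.1555077425 ∣ 0.1117307010,
at the far end `U = 100`: 0.1555077425 ∣ 0.1117307010). [cite: Israel1979, Thm. I.2.4] [cite: EmeryKivelsonLin1990, pp. 475–476] [cite: Ruelle1969, §3.3] -/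
theorem se78p_1o4_B_above (h595 : cert_r595_bs_GU12n7o8tpm3o10_w3_b4_R2_ob5p2_kry1_kry2c3rel_hanK7B4D4_KN4_PR20d4_uprime) (h592 : cert_r592_bs_GU12n7o8tpm1o5_w3_b4_R2_ob5p2_kry1_kry2c3rel_hanK7B4D4_KN4_PR20d4_uprime)
    {s : ℝ} (hs : s ∈ Icc (-3 / 10 : ℝ) (-1 / 5 : ℝ)) {U : ℝ} (hU : U ∈ Icc (12 : ℝ) (100 : ℝ))
    {ω₁ ω₂ : InfVolFermionState 2} (h₁ : ω₁.IsTranslationInvariant) (h₂ : ω₂.IsTranslationInvariant)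
    (hρ₁ : 0 < ω₁.density) (hρ₁' : ω₁.density ≤ (1 / 4)) (hρ₂ : 7 / 8 ≤ ω₂.density) (hρ₂' : ω₂.density < 2)
    {lam : ℝ} (hl0 : 0 < lam) (hl1 : lam < 1) :
    energyDensityTT' 1 s U (mix lam hl0.le hl1.le ω₁ ω₂).density <
      (mix lam hl0.le hl1.le ω₁ ω₂).meanEnergy (hubbardTTPrimeFermionInteraction 1 s U) 1 := by
  refine ps_not_groundState_mix_above_column_tcap 1 (s₁ := -3 / 10) (s₂ := -1 / 5) (U₂ := 12) (U₃ := 100)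
    (n₁ := (1 / 4)) (n₂ := 7 / 8) (a := 3 / 5) (b := 2 / 5) (by norm_num) (by norm_num) (by norm_num) (by norm_num)
    (by norm_num) (by norm_num) (by norm_num) (by norm_num)
    (polHalf_m30m20_tcap_on_cell (by norm_num) (by norm_num) (by norm_num) (by norm_num))
    (fun s hs => se78_col12_m30m20 h595 h592 s ⟨hs.1.trans' (by norm_num), hs.2.trans (by norm_num)⟩)
    (fun s hs U hU => se78_dilute1o4_m30m20 (n₁ := (1 / 4)) (by norm_num) (by norm_num) s ⟨hs.1.trans' (by norm_num), hs.2.trans (by norm_num)⟩ U (by linarith [hU.1]))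
    ?_ hs hU h₁ h₂ hρ₁ hρ₁' hρ₂ hρ₂' hl0 hl1
  intro s hs; obtain ⟨h1, h2⟩ := hs; push_cast; norm_num; nlinarith [h1, h2]

/-- **THE `(≤ 1/4 | ≥ 7/8)` SENTENCE ON `t′ ∈ [-3 / 10, -1 / 5] × U ∈ [12, 100]`** (segment B; union of 1 piece(s) in `U`). For every `(s, U)` of the
rectangle no mixture `λω₁ + (1−λ)ω₂` (`0 < λ < 1`) of translation-invariant states of the 2D `t–t′` Hubbard model at `(1, s, U)` with densities `0 < ρ(ω₁) ≤ 1/4` and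
`7/8 ≤ ρ(ω₂) < 2` is a ground state — at ANY filling in between: the hole-poor member may carry ANY hole doping up to `1/8` (or be electron doped). Conditional BY NAME on
the registry claim nodes in the signature (`n = 7/8` corner floors, and the r468 plane where it is the cap); kernel HF caps and dilute floors are premise-free. [cite: Israel1979, Thm. I.2.4] [cite: EmeryKivelsonLin1990, pp. 475–476] [cite: Ruelle1969, §3.3] -/
theorem sevenEighthsPol_not_groundState_mix_le_1o4_ge_7o8_B (h595 : cert_r595_bs_GU12n7o8tpm3o10_w3_b4_R2_ob5p2_kry1_kry2c3rel_hanK7B4D4_KN4_PR20d4_uprime) (h592 : cert_r592_bs_GU12n7o8tpm1o5_w3_b4_R2_ob5p2_kry1_kry2c3rel_hanK7B4D4_KN4_PR20d4_uprime)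
    {s : ℝ} (hs : s ∈ Icc (-3 / 10 : ℝ) (-1 / 5 : ℝ)) {U : ℝ} (hU : U ∈ Icc (12 : ℝ) (100 : ℝ))
    {ω₁ ω₂ : InfVolFermionState 2} (h₁ : ω₁.IsTranslationInvariant) (h₂ : ω₂.IsTranslationInvariant)
    (hρ₁ : 0 < ω₁.density) (hρ₁' : ω₁.density ≤ (1 / 4)) (hρ₂ : 7 / 8 ≤ ω₂.density) (hρ₂' : ω₂.density < 2)
    {lam : ℝ} (hl0 : 0 < lam) (hl1 : lam < 1) :
    energyDensityTT' 1 s U (mix lam hl0.le hl1.le ω₁ ω₂).density <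
      (mix lam hl0.le hl1.le ω₁ ω₂).meanEnergy (hubbardTTPrimeFermionInteraction 1 s U) 1 := by
  exact se78p_1o4_B_above h595 h592 hs hU h₁ h₂ hρ₁ hρ₁' hρ₂ hρ₂' hl0 hl1


/-! ## The `(≤ 3/10 | ≥ 7/8)` cells and rectangle words -/

/-- **`(≤ 3/10 | ≥ 7/8)` — segment B above the column `U = 12`: `t′ ∈ [-3 / 10, -1 / 5]`, `U ∈ [12, 100]`** (cap filling `1 / 2`, weights
`15 / 23, 8 / 23`; cap = the PROVED kernel FULLY-POLARISED band cap `polHalf_m30m20` (one spin species at density `1 / 2`, `U`-independent; no claim node); the `n = 7/8` column law `se78_col12_m30m20` floors every larger `U`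
[folklore: `energyDensityTT'_mono_U`]; the cap grows by `c₁ = 0.0000000` per unit `U`; margins at `U = 12`: 0.0937191496 ∣ 0.0422128160,
at the far end `U = 100`: 0.0937191496 ∣ 0.0422128160). [cite: Israel1979, Thm. I.2.4] [cite: EmeryKivelsonLin1990, pp. 475–476] [cite: Ruelle1969, §3.3] -/
theorem se78p_3o10_B_above (h595 : cert_r595_bs_GU12n7o8tpm3o10_w3_b4_R2_ob5p2_kry1_kry2c3rel_hanK7B4D4_KN4_PR20d4_uprime) (h592 : cert_r592_bs_GU12n7o8tpm1o5_w3_b4_R2_ob5p2_kry1_kry2c3rel_hanK7B4D4_KN4_PR20d4_uprime)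
    {s : ℝ} (hs : s ∈ Icc (-3 / 10 : ℝ) (-1 / 5 : ℝ)) {U : ℝ} (hU : U ∈ Icc (12 : ℝ) (100 : ℝ))
    {ω₁ ω₂ : InfVolFermionState 2} (h₁ : ω₁.IsTranslationInvariant) (h₂ : ω₂.IsTranslationInvariant)
    (hρ₁ : 0 < ω₁.density) (hρ₁' : ω₁.density ≤ (3 / 10)) (hρ₂ : 7 / 8 ≤ ω₂.density) (hρ₂' : ω₂.density < 2)
    {lam : ℝ} (hl0 : 0 < lam) (hl1 : lam < 1) :
    energyDensityTT' 1 s U (mix lam hl0.le hl1.le ω₁ ω₂).density <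
      (mix lam hl0.le hl1.le ω₁ ω₂).meanEnergy (hubbardTTPrimeFermionInteraction 1 s U) 1 := by
  refine ps_not_groundState_mix_above_column_tcap 1 (s₁ := -3 / 10) (s₂ := -1 / 5) (U₂ := 12) (U₃ := 100)
    (n₁ := (3 / 10)) (n₂ := 7 / 8) (a := 15 / 23) (b := 8 / 23) (by norm_num) (by norm_num) (by norm_num) (by norm_num)
    (by norm_num) (by norm_num) (by norm_num) (by norm_num)
    (polHalf_m30m20_tcap_on_cell (by norm_num) (by norm_num) (by norm_num) (by norm_num))
    (fun s hs => se78_col12_m30m20 h595 h592 s ⟨hs.1.trans' (by norm_num), hs.2.trans (by norm_num)⟩)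
    (fun s hs U hU => se78_dilute3o10_m30m20 (n₁ := (3 / 10)) (by norm_num) (by norm_num) s ⟨hs.1.trans' (by norm_num), hs.2.trans (by norm_num)⟩ U (by linarith [hU.1]))
    ?_ hs hU h₁ h₂ hρ₁ hρ₁' hρ₂ hρ₂' hl0 hl1
  intro s hs; obtain ⟨h1, h2⟩ := hs; push_cast; norm_num; nlinarith [h1, h2]

/-- **THE `(≤ 3/10 | ≥ 7/8)` SENTENCE ON `t′ ∈ [-3 / 10, -1 / 5] × U ∈ [12, 100]`** (segment B; union of 1 piece(s) in `U`). For every `(s, U)` of the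
rectangle no mixture `λω₁ + (1−λ)ω₂` (`0 < λ < 1`) of translation-invariant states of the 2D `t–t′` Hubbard model at `(1, s, U)` with densities `0 < ρ(ω₁) ≤ 3/10` and
`7/8 ≤ ρ(ω₂) < 2` is a ground state — at ANY filling in between: the hole-poor member may carry ANY hole doping up to `1/8` (or be electron doped). Conditional BY NAME on
the registry claim nodes in the signature (`n = 7/8` corner floors, and the r468 plane where it is the cap); kernel HF caps and dilute floors are premise-free. [cite: Israel1979, Thm. I.2.4] [cite: EmeryKivelsonLin1990, pp. 475–476] [cite: Ruelle1969, §3.3] -/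
theorem sevenEighthsPol_not_groundState_mix_le_3o10_ge_7o8_B (h595 : cert_r595_bs_GU12n7o8tpm3o10_w3_b4_R2_ob5p2_kry1_kry2c3rel_hanK7B4D4_KN4_PR20d4_uprime) (h592 : cert_r592_bs_GU12n7o8tpm1o5_w3_b4_R2_ob5p2_kry1_kry2c3rel_hanK7B4D4_KN4_PR20d4_uprime)
    {s : ℝ} (hs : s ∈ Icc (-3 / 10 : ℝ) (-1 / 5 : ℝ)) {U : ℝ} (hU : U ∈ Icc (12 : ℝ) (100 : ℝ))
    {ω₁ ω₂ : InfVolFermionState 2} (h₁ : ω₁.IsTranslationInvariant) (h₂ : ω₂.IsTranslationInvariant)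
    (hρ₁ : 0 < ω₁.density) (hρ₁' : ω₁.density ≤ (3 / 10)) (hρ₂ : 7 / 8 ≤ ω₂.density) (hρ₂' : ω₂.density < 2)
    {lam : ℝ} (hl0 : 0 < lam) (hl1 : lam < 1) :
    energyDensityTT' 1 s U (mix lam hl0.le hl1.le ω₁ ω₂).density <
      (mix lam hl0.le hl1.le ω₁ ω₂).meanEnergy (hubbardTTPrimeFermionInteraction 1 s U) 1 := by
  exact se78p_3o10_B_above h595 h592 hs hU h₁ h₂ hρ₁ hρ₁' hρ₂ hρ₂' hl0 hl1

end Summit.Ventures.CertifiedManyBodySolver.Observables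

end
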